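import Summits.HodgeConjecture.HodgeConjecture.Theses.HeckePrymWeil
import Summits.HodgeConjecture.HodgeConjecture.Theorems.WeilTwelvefoldsSqrtMinus7.Negative.EigenvalueTyping
import Summits.HodgeConjecture.HodgeConjecture.Theorems.WeilTwelvefoldsSqrtMinus7.Negative.WeilPlaneReality
import Summits.HodgeConjecture.HodgeConjecture.Theorems.WeilSixfoldsSqrtMinus7.Negative.EigenvalueSeparation

/-!
# `HyperbolicEightfoldsSqrtMinus7` (stmt-HodgeConjecture-14642) · Negative · the typed Weil plane in degree 8

Negative-side / tightness knowledge for the crux `HeckePrymWeil.HyperbolicEightfoldsSqrtMinus7`, extracted from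
the standing disprover's work file `Cruxes/HyperbolicEightfoldsSqrtMinus7/Disproof.lean` §2
(refuter-cdisprove-stmt-HodgeConjecture-14642-0, cycle 1, 2026-08-16).  Degree-8 instances of the generic lemmas
landed for the sibling cruxes (`WeilTwelvefoldsSqrtMinus7/Negative/{EigenvalueTyping, WeilPlaneReality}`,
`WeilSixfoldsSqrtMinus7/Negative/EigenvalueSeparation`), valid for EVERY abelian variety `A` and EVERY
endomorphism `ψ` unless stated otherwise.

* `weilEigenvalues_eight_ne`, `one_add_I_sqrt7_pow_eight`, `one_sub_I_sqrt7_pow_eight`, `mixed_eight`: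
  the typing `Eig((𝟙+φ)^*, (1+i√7)⁸) ⊔ Eig((𝟙+φ)^*, (1-i√7)⁸)` is a DIRECT sum (`(1±i√7)⁸ = -3968 ∓ 384·i√7`)
  and no mixed Künneth–Hodge summand `∧ᵃH¹_σ ⊗ ∧ᵇH¹_σ̄`, `a + b = 8`, carries either eigenvalue;
* `mem_weilPlane8_iff`: the plane is the kernel of the RATIONAL operator `T² + 7936·T + 8⁸`, `T = (𝟙+φ)^*`
  (so it is defined over `ℚ`: `IsRationalClass c` is not load-bearing in the crux);
* `rational_mem_plusEigenspace8_eq_zero` / `…minus…`, `onlyPlusVariant_holds` / `onlyMinusVariant_holds`: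
  REFUTED-AS-VACUOUS strengthenings of the typing — a rational class in ONE typed eigenspace is `0`, so the
  single-eigenspace variants of the crux hold outright with no other hypothesis: the `⊔` is essential;
* `weilComponents8_conj`, `weilComponents8_ne_zero`: the components `c = c₊ + c₋` of a rational class of the
  plane are conjugate, and both non-zero and non-rational unless `c = 0` — the only shape of a counterexample;
* `hyperbolicEightfoldsSqrtMinus7_iff_componentwise`: the crux is equivalent to its componentwise form;
* `weilComponents8_algebraic_of_algebraic`: if `ψ^*` preserves algebraic classes (flat pull-back; `𝟙+φ` is an
  isogeny) the components of an ALGEBRAIC class of the plane are algebraic — the Lean half of "one non-zero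
  algebraic class per `(A, φ)` suffices" (Markman, arXiv:2509.23079 §1).
-/

noncomputable section

set_option linter.dupNamespace false

open Complex CategoryTheory
open Literature.AlgebraicGeometry Literature.AlgebraicGeometry.HodgeTheory
open Literature.AlgebraicTopology.SingularHomology

namespace Summit.HodgeConjecture.HodgeConjecture.Theorems.HyperbolicEightfoldsSqrtMinus7.Negative

open Summit.HodgeConjecture.HodgeConjecture.Theses.HeckePrymWeil
open Summit.HodgeConjecture.HodgeConjecture.Theorems.WeilTwelvefoldsSqrtMinus7.Negative
  (one_add_I_sqrt7_pow_ne mixed_eq_plus_iff mixed_eq_minus_iff one_add_I_sqrt7_pow one_sub_I_sqrt7_pow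
    conj_one_add_I_sqrt7_pow conj_one_sub_I_sqrt7_pow eq_zero_of_isRationalClass_of_mem_eigenspace
    conjClass_mem_eigenspace_map eq_zero_of_mem_eigenspace_of_mem_eigenspace components_mem_span_pair)
open Summit.HodgeConjecture.HodgeConjecture.Theorems.WeilSixfoldsSqrtMinus7.Negative
  (mem_eigenspace_sup_eigenspace_iff I_mul_sqrt_seven_sq)

/-! ## The eigenvalues at exponent 8 -/

/-- **`(1+i√7)⁸ ≠ (1-i√7)⁸`**: the `⊔` of the crux is a direct sum of two distinct eigenspaces of `(𝟙+φ)^*`.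
[folklore] -/
theorem weilEigenvalues_eight_ne :
    (1 + I * (Real.sqrt (7 : ℝ) : ℂ)) ^ 8 ≠ (1 - I * (Real.sqrt (7 : ℝ) : ℂ)) ^ 8 :=
  one_add_I_sqrt7_pow_ne 8 (by norm_num)

/-- `(1+√-7)⁸ = -3968 - 384·√-7` in `ℤ[√-7]` (kernel computation; `3968² + 7·384² = 8⁸`). [folklore] -/
theorem one_add_sqrtNeg7_pow_eight : (⟨1, 1⟩ : ℤ√(-7)) ^ 8 = ⟨-3968, -384⟩ := by decide

/-- **Explicit typed eigenvalue** `(1+i√7)⁸ = -3968 - 384·i√7`. [folklore] -/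
theorem one_add_I_sqrt7_pow_eight :
    (1 + I * (Real.sqrt (7 : ℝ) : ℂ)) ^ 8 = (-3968 : ℂ) - (384 : ℂ) * (I * (Real.sqrt (7 : ℝ) : ℂ)) := by
  rw [one_add_I_sqrt7_pow, one_add_sqrtNeg7_pow_eight]; push_cast; ring

/-- `(1-i√7)⁸ = -3968 + 384·i√7`. [folklore] -/
theorem one_sub_I_sqrt7_pow_eight :
    (1 - I * (Real.sqrt (7 : ℝ) : ℂ)) ^ 8 = (-3968 : ℂ) + (384 : ℂ) * (I * (Real.sqrt (7 : ℝ) : ℂ)) := by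
  rw [one_sub_I_sqrt7_pow, one_add_sqrtNeg7_pow_eight]; push_cast; ring

/-- **No mixed summand carries a Weil eigenvalue** (`a + b = 8`): `λ₊ᵃλ₋ᵇ = λ₊⁸ ↔ b = 0` and
`λ₊ᵃλ₋ᵇ = λ₋⁸ ↔ a = 0` — the hypothesis `c ∈ Eig ⊔ Eig` cuts out exactly `∧⁸H¹_σ ⊕ ∧⁸H¹_σ̄` (granted
`H⁸(A) = ∧⁸H¹(A)`). [folklore] -/
theorem mixed_eight (a b : ℕ) (hab : a + b = 8) :
    ((1 + I * (Real.sqrt (7 : ℝ) : ℂ)) ^ a * (1 - I * (Real.sqrt (7 : ℝ) : ℂ)) ^ b =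
        (1 + I * (Real.sqrt (7 : ℝ) : ℂ)) ^ 8 ↔ b = 0) ∧
    ((1 + I * (Real.sqrt (7 : ℝ) : ℂ)) ^ a * (1 - I * (Real.sqrt (7 : ℝ) : ℂ)) ^ b =
        (1 - I * (Real.sqrt (7 : ℝ) : ℂ)) ^ 8 ↔ a = 0) := by
  rw [← hab]
  exact ⟨mixed_eq_plus_iff a b, mixed_eq_minus_iff a b⟩

/-- **The typed plane is cut out by a RATIONAL operator identity**: for an endomorphism `f` of a complex vector
space, `x ∈ Eig(f, λ₊⁸) ⊔ Eig(f, λ₋⁸) ↔ f(f x) + 7936·f x + 16777216·x = 0` (`λ₊⁸ + λ₋⁸ = -7936`,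
`λ₊⁸λ₋⁸ = 8⁸`; `T² + 7936T + 8⁸` has discriminant `-7·768²`, irreducible over `ℚ`). [folklore] -/
theorem mem_weilPlane8_iff {V : Type*} [AddCommGroup V] [Module ℂ V] (f : Module.End ℂ V) (x : V) :
    x ∈ f.eigenspace ((1 + I * (Real.sqrt (7 : ℝ) : ℂ)) ^ 8) ⊔ f.eigenspace ((1 - I * (Real.sqrt (7 : ℝ) : ℂ)) ^ 8) ↔
      f (f x) + (7936 : ℂ) • f x + (16777216 : ℂ) • x = 0 := by
  have ht := I_mul_sqrt_seven_sq
  have hsum : (1 + I * (Real.sqrt (7 : ℝ) : ℂ)) ^ 8 + (1 - I * (Real.sqrt (7 : ℝ) : ℂ)) ^ 8 = -7936 := by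
    rw [one_add_I_sqrt7_pow_eight, one_sub_I_sqrt7_pow_eight]; ring
  have hprod : (1 + I * (Real.sqrt (7 : ℝ) : ℂ)) ^ 8 * (1 - I * (Real.sqrt (7 : ℝ) : ℂ)) ^ 8 = 16777216 := by
    rw [one_add_I_sqrt7_pow_eight, one_sub_I_sqrt7_pow_eight]
    linear_combination (-147456 : ℂ) * ht
  rw [mem_eigenspace_sup_eigenspace_iff f weilEigenvalues_eight_ne, hsum, hprod, neg_smul, sub_neg_eq_add]

/-- `conj((1+i√7)⁸) ≠ (1+i√7)⁸`: the typed eigenvalue is not real. [folklore] -/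
theorem conj_weilEigenvalue_eight_ne :
    starRingEnd ℂ ((1 + I * (Real.sqrt (7 : ℝ) : ℂ)) ^ 8) ≠ (1 + I * (Real.sqrt (7 : ℝ) : ℂ)) ^ 8 := by
  rw [conj_one_add_I_sqrt7_pow]; exact weilEigenvalues_eight_ne.symm

/-- Mirror. [folklore] -/
theorem conj_weilEigenvalueBar_eight_ne :
    starRingEnd ℂ ((1 - I * (Real.sqrt (7 : ℝ) : ℂ)) ^ 8) ≠ (1 - I * (Real.sqrt (7 : ℝ) : ℂ)) ^ 8 := by
  rw [conj_one_sub_I_sqrt7_pow]; exact weilEigenvalues_eight_ne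

/-! ## Crux level: the typed plane of `(A, ψ)` in `H⁸(A(ℂ); ℂ)` -/

variable (A : Motives.AbelianVariety ℂ) (ψ : A ⟶ A)

/-- **A rational class in the `+` typed eigenspace ALONE is `0`** (degree 8, every `A`, every `ψ`).
[cite: VoisinHodgeI2002, Cor. 6.12] -/
theorem rational_mem_plusEigenspace8_eq_zero {c : complexBetti A.X 8} (hr : IsRationalClass c)
    (hc : c ∈ Module.End.eigenspace (complexBetti.map ψ.hom.hom.hom 8).hom ((1 + I * (Real.sqrt (7 : ℝ) : ℂ)) ^ 8)) :
    c = 0 :=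
  eq_zero_of_isRationalClass_of_mem_eigenspace _ conj_weilEigenvalue_eight_ne hr hc

/-- Mirror (`-` eigenspace alone). [cite: VoisinHodgeI2002, Cor. 6.12] -/
theorem rational_mem_minusEigenspace8_eq_zero {c : complexBetti A.X 8} (hr : IsRationalClass c)
    (hc : c ∈ Module.End.eigenspace (complexBetti.map ψ.hom.hom.hom 8).hom ((1 - I * (Real.sqrt (7 : ℝ) : ℂ)) ^ 8)) :
    c = 0 :=
  eq_zero_of_isRationalClass_of_mem_eigenspace _ conj_weilEigenvalueBar_eight_ne hr hc

/-- **Refuted-as-vacuous strengthening of the typing (`+` only)**: the variant of the crux keeping only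
`Eig((𝟙+φ)^*, (1+i√7)⁸)` holds outright — every admissible class is `0` — with NONE of the other hypotheses
(dimension, Weil relation, polarization, hyperbolicity, Hodge type).  The `⊔` is essential. [folklore] -/
theorem onlyPlusVariant_holds :
    ∀ (A : Motives.AbelianVariety ℂ) (φ : A ⟶ A) (c : complexBetti A.X 8), IsRationalClass c →
      c ∈ Module.End.eigenspace (complexBetti.map (𝟙 A + φ).hom.hom.hom 8).hom ((1 + I * (Real.sqrt (7 : ℝ) : ℂ)) ^ 8) →
      c ∈ algebraicClasses A.X 4 := by
  intro A φ c hr hc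
  rw [rational_mem_plusEigenspace8_eq_zero A _ hr hc]
  exact Submodule.zero_mem _

/-- Mirror (`-` only). [folklore] -/
theorem onlyMinusVariant_holds :
    ∀ (A : Motives.AbelianVariety ℂ) (φ : A ⟶ A) (c : complexBetti A.X 8), IsRationalClass c →
      c ∈ Module.End.eigenspace (complexBetti.map (𝟙 A + φ).hom.hom.hom 8).hom ((1 - I * (Real.sqrt (7 : ℝ) : ℂ)) ^ 8) →
      c ∈ algebraicClasses A.X 4 := by
  intro A φ c hr hc
  rw [rational_mem_minusEigenspace8_eq_zero A _ hr hc]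
  exact Submodule.zero_mem _

/-- **The two components of a rational class of the typed plane are conjugate** (degree 8).
[cite: VoisinHodgeI2002, Cor. 6.12] -/
theorem weilComponents8_conj {c cp cm : complexBetti A.X 8} (hr : IsRationalClass c)
    (hp : cp ∈ Module.End.eigenspace (complexBetti.map ψ.hom.hom.hom 8).hom ((1 + I * (Real.sqrt (7 : ℝ) : ℂ)) ^ 8))
    (hm : cm ∈ Module.End.eigenspace (complexBetti.map ψ.hom.hom.hom 8).hom ((1 - I * (Real.sqrt (7 : ℝ) : ℂ)) ^ 8))
    (hc : c = cp + cm) : conjClass _ 8 cp = cm := by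
  have hp' := conjClass_mem_eigenspace_map _ hp
  have hm' := conjClass_mem_eigenspace_map _ hm
  rw [conj_one_add_I_sqrt7_pow] at hp'
  rw [conj_one_sub_I_sqrt7_pow] at hm'
  have hcc : conjClass _ 8 cp + conjClass _ 8 cm = cp + cm := by
    rw [← conjClass_add, ← hc, hr.conjClass_eq]
  have hd1 : conjClass _ 8 cp - cm ∈ Module.End.eigenspace (complexBetti.map ψ.hom.hom.hom 8).hom
      ((1 - I * (Real.sqrt (7 : ℝ) : ℂ)) ^ 8) := Submodule.sub_mem _ hp' hm
  have heq : conjClass _ 8 cp - cm = cp - conjClass _ 8 cm := by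
    rw [sub_eq_sub_iff_add_eq_add, hcc]
  have hd2 : conjClass _ 8 cp - cm ∈ Module.End.eigenspace (complexBetti.map ψ.hom.hom.hom 8).hom
      ((1 + I * (Real.sqrt (7 : ℝ) : ℂ)) ^ 8) := by
    rw [heq]; exact Submodule.sub_mem _ hp hm'
  exact sub_eq_zero.1 (eq_zero_of_mem_eigenspace_of_mem_eigenspace _ weilEigenvalues_eight_ne hd2 hd1)

/-- **Both components of a non-zero rational class of the typed plane are non-zero and non-rational** — the
only shape a counterexample class can have. [folklore] -/
theorem weilComponents8_ne_zero {c cp cm : complexBetti A.X 8} (hr : IsRationalClass c)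
    (hp : cp ∈ Module.End.eigenspace (complexBetti.map ψ.hom.hom.hom 8).hom ((1 + I * (Real.sqrt (7 : ℝ) : ℂ)) ^ 8))
    (hm : cm ∈ Module.End.eigenspace (complexBetti.map ψ.hom.hom.hom 8).hom ((1 - I * (Real.sqrt (7 : ℝ) : ℂ)) ^ 8))
    (hc : c = cp + cm) (hc0 : c ≠ 0) :
    cp ≠ 0 ∧ cm ≠ 0 ∧ ¬ IsRationalClass cp ∧ ¬ IsRationalClass cm := by
  have hconj := weilComponents8_conj A ψ hr hp hm hc
  have key : IsRationalClass cp → False := fun hxr => by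
    have h0 : cp = 0 := rational_mem_plusEigenspace8_eq_zero A ψ hxr hp
    have h1 := hconj
    rw [h0, conjClass_zero] at h1
    exact hc0 (by rw [hc, h0, ← h1, add_zero])
  have key' : IsRationalClass cm → False := fun hxr => by
    have h0 : cm = 0 := rational_mem_minusEigenspace8_eq_zero A ψ hxr hm
    have h1 := hconj
    rw [h0] at h1
    have h2 : cp = 0 := by
      have := congrArg (conjClass _ 8) h1
      rwa [conjClass_conjClass, conjClass_zero] at this
    exact hc0 (by rw [hc, h0, h2, add_zero])
  exact ⟨fun h0 => key (h0 ▸ IsRationalClass.zero), fun h0 => key' (h0 ▸ IsRationalClass.zero), key, key'⟩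

/-- **The crux is equivalent to its COMPONENTWISE form** (non-zero class, two non-zero conjugate components)
— the only shape in which a counterexample can exist. [folklore] -/
theorem hyperbolicEightfoldsSqrtMinus7_iff_componentwise :
    HyperbolicEightfoldsSqrtMinus7 ↔
    ∀ (A : Motives.AbelianVariety ℂ) (φ : A ⟶ A), A.dim = 8 → φ ≫ φ = -((7 : ℤ) • 𝟙 A) →
      ∀ (e : Motives.ProjectiveEmbedding A.X) (a : complexBetti (Motives.projectiveSpace e.n ℂ) 2),
        IsRationalClass a → a ≠ 0 →
        Motives.IsHyperbolicWeilType A φ 4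
          ((7 : ℂ) • complexBetti.map e.ι 2 a + complexBetti.map φ.hom.hom.hom 2 (complexBetti.map e.ι 2 a)) →
      ∀ c cp cm : complexBetti A.X 8, IsRationalClass c → IsOfHodgeType 8 A.X 8 4 4 c →
        cp ∈ Module.End.eigenspace (complexBetti.map (𝟙 A + φ).hom.hom.hom 8).hom ((1 + I * (Real.sqrt (7 : ℝ) : ℂ)) ^ 8) →
        cm ∈ Module.End.eigenspace (complexBetti.map (𝟙 A + φ).hom.hom.hom 8).hom ((1 - I * (Real.sqrt (7 : ℝ) : ℂ)) ^ 8) →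
        c = cp + cm → cp ≠ 0 → cm ≠ 0 → c ∈ algebraicClasses A.X 4 := by
  constructor
  · intro h A φ hA hφ e a ha ha0 hyp c cp cm hr hH hp hm hc _ _
    exact h A φ hA hφ e a ha ha0 hyp c hr hH (hc ▸ Submodule.add_mem_sup hp hm)
  · intro h A φ hA hφ e a ha ha0 hyp c hr hH hW
    obtain ⟨cp, hp, cm, hm, hsum⟩ := Submodule.mem_sup.1 hW
    by_cases hc0 : c = 0
    · rw [hc0]; exact Submodule.zero_mem _
    have hne := weilComponents8_ne_zero A _ hr hp hm hsum.symm hc0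
    exact h A φ hA hφ e a ha ha0 hyp c cp cm hr hH hp hm hsum.symm hne.1 hne.2.1

/-- **"One non-zero algebraic class per `(A, φ)` suffices" — the Lean half.**  If `ψ^*` preserves algebraic
classes in degree 8 (true for `ψ = 𝟙+φ`: an isogeny, `(𝟙+φ)(𝟙-φ) = 8`, hence flat — the tree's
`map_mem_algebraicClasses_of_flat`; assumed here), then the two Weil components of an ALGEBRAIC class of the
typed plane are algebraic (2×2 inversion with coefficients in `ℚ(λ₊⁸) ⊂ ℂ`). [folklore] -/
theorem weilComponents8_algebraic_of_algebraic
    (hstab : ∀ x ∈ algebraicClasses A.X 4, complexBetti.map ψ.hom.hom.hom 8 x ∈ algebraicClasses A.X 4)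
    {c cp cm : complexBetti A.X 8}
    (hp : cp ∈ Module.End.eigenspace (complexBetti.map ψ.hom.hom.hom 8).hom ((1 + I * (Real.sqrt (7 : ℝ) : ℂ)) ^ 8))
    (hm : cm ∈ Module.End.eigenspace (complexBetti.map ψ.hom.hom.hom 8).hom ((1 - I * (Real.sqrt (7 : ℝ) : ℂ)) ^ 8))
    (hc : c = cp + cm) (halg : c ∈ algebraicClasses A.X 4) :
    cp ∈ algebraicClasses A.X 4 ∧ cm ∈ algebraicClasses A.X 4 := by
  have h2 := components_mem_span_pair (complexBetti.map ψ.hom.hom.hom 8).hom weilEigenvalues_eight_ne hp hm hc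
  have hle : Submodule.span ℂ {c, (complexBetti.map ψ.hom.hom.hom 8).hom c} ≤ algebraicClasses A.X 4 := by
    rw [Submodule.span_le]
    intro x hx
    rcases hx with rfl | hx
    · exact halg
    · rw [Set.mem_singleton_iff.1 hx]; exact hstab _ halg
  exact ⟨hle h2.1, hle h2.2⟩

end Summit.HodgeConjecture.HodgeConjecture.Theorems.HyperbolicEightfoldsSqrtMinus7.Negative

end
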